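import Literature.NumberTheory.Sieve.MaynardTao
import Literature.NumberTheory.Sieve.ParityBarrier
import HarnessLib

/-!
# Maynard's Theorem 1.4 (bounded gaps under Elliott–Halberstam): the deduction from Props. 4.2, 4.3

J. Maynard, *Small gaps between primes*, Ann. of Math. (2) 181 (2015), 383–413
(doi:10.4007/annals.2015.181.1.7 = arXiv:1311.4600), Theorem 1.4 in the numbering of the held
arXiv text (the docstring of the target in `ParityWave0` calls the same statement "Thm 1.3"):
*Assume that the primes have level of distribution `θ` for every `θ < 1`. Then
`liminf_n (p_{n+1} − p_n) ≤ 12`.*  This is the vendored named fact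
`Literature.NumberTheory.Sieve.frequently_nth_prime_succ_le_add_of_elliottHalberstam` (parity.S13).

The printed proof (§4, p. 8 of the arXiv text) is three lines: "Next we take `k = 5` and
`H = {0, 2, 6, 8, 12}`, with `θ = 1 − ε` again. By Proposition 4.3 we have `M_5 > 2`, and so
`θ M_5 / 2 > 1` for `ε` sufficiently small. Thus, by Proposition 4.2,
`liminf_n (p_{n+1} − p_n) ≤ 12` under the Elliott–Halberstam conjecture."  Proposition 4.2 ends
with "In particular, `liminf_n (p_{n+r_k−1} − p_n) ≤ max_{1 ≤ i,j ≤ k} (h_i − h_j)`."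

This file proves exactly this deduction, sorry-free, from three inputs that are named facts of the
tree (all in `Literature/NumberTheory/Sieve`):

* `Literature.NumberTheory.Sieve.frequently_card_primes_ge_of_maynardFunctional` (`MaynardTao`; Maynard Prop. 4.2 with the
  conclusion of Thm 3.1: level `θ > 0`, an admissible `k`-tuple `H`, an admissible test function `F`
  with `(∑ₘ J_k^{(m)}(F)) / I_k(F) > 2m/θ` ⇒ infinitely often at least `m + 1` of the `n + h`,
  `h ∈ H`, are prime) — the Maynard–Tao sieve proper, OPEN in the tree;
* `Literature.NumberTheory.Sieve.exists_two_lt_maynardFunctional_five` (`MaynardTao`; Maynard Prop. 4.3 (1): `M_5 > 2`,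
  §7: an explicit polynomial `F` in `P₁ = ∑ tᵢ`, `P₂ = ∑ tᵢ²` with ratio `1417255/708216 > 2`);
* `Literature.NumberTheory.Sieve.elliottHalberstam_iff_wave0` (`ParityBarrier`; the bridge between the level-of-distribution
  form `Literature.ElliottHalberstam = ∀ θ < 1, PrimesHaveLevel θ` consumed by Prop. 4.2 and the Wave0
  form `Literature.Parity.ElliottHalberstamConjecture = ∀ θ < 1, EH θ` in which the target is stated).

The two elementary steps of the printed argument are proved here:

* `Literature.NumberTheory.Sieve.isAdmissibleTuple_maynardFive` — `{0, 2, 6, 8, 12}` is admissible (only `p = 2, 3, 5` need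
  checking, `Literature.NumberTheory.Sieve.isAdmissibleTuple_iff_of_le_card`);
* `Literature.NumberTheory.Sieve.frequently_nth_prime_succ_le_of_frequently_two_le_card` — the "in particular" of Prop. 4.2
  for `r_k = 2`: if infinitely often two of the `n + h`, `h ∈ H`, are prime and `H` has diameter
  `≤ D`, then `p_{k+1} ≤ p_k + D` for infinitely many `k` (the two primes are `p_j < p_{j'}` with
  `p_{j+1} ≤ p_{j'} ≤ p_j + D`, and `j → ∞` with `n`).

Main result: `Literature.NumberTheory.Sieve.frequently_nth_prime_succ_le_add_of_elliottHalberstam_of` — the target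
follows from the three named facts. The remaining work towards
`frequently_nth_prime_succ_le_add_of_elliottHalberstam_holds` is exactly the discharge of those
facts (Prop. 4.3 (1) is a finite computation with Dirichlet integrals over the simplex; the bridge is
standard, Iwaniec–Kowalski §17.1; Prop. 4.2 is the sieve, Maynard §§5–6).

## References

* J. Maynard, *Small gaps between primes*, Ann. of Math. (2) 181 (2015), no. 1, 383–413,
  doi:10.4007/annals.2015.181.1.7, arXiv:1311.4600; §1 Theorem 1.4, §4 Propositions 4.2, 4.3 and
  the proof of Theorem 1.4 (p. 8). [cite: MaynardAnnals2015]
-/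

open Filter Finset

namespace Literature.NumberTheory.Sieve

/-- Maynard's `5`-tuple `H = {0, 2, 6, 8, 12}` (Maynard, Ann. of Math. 181 (2015), §4, proof of
Theorem 1.4) is admissible: by `isAdmissibleTuple_iff_of_le_card` only the primes `p ≤ #H = 5`
matter, and `H` occupies `1 < 2`, `2 < 3` and `4 < 5` residue classes modulo `2`, `3`, `5`.
[cite: MaynardAnnals2015, §4, proof of Theorem 1.4 (choice H = {0,2,6,8,12})] -/
theorem isAdmissibleTuple_maynardFive : IsAdmissibleTuple ({0, 2, 6, 8, 12} : Finset ℤ) := by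
  rw [isAdmissibleTuple_iff_of_le_card]
  intro p hp hle
  have h5 : p ≤ 5 := hle.trans (by decide)
  have h2 : 2 ≤ p := hp.two_le
  interval_cases p
  · decide
  · decide
  · exact absurd hp (by norm_num)
  · decide

/-- The last sentence of Maynard's Proposition 4.2 ("In particular,
`liminf_n (p_{n+r_k−1} − p_n) ≤ max_{1 ≤ i, j ≤ k} (h_i − h_j)`") in the case `r_k = 2`, in the
`∃ᶠ` phrasing of the Wave0 statements: if for infinitely many `n` at least two of the `n + h`
(`h ∈ H`) are (positive) primes, and all differences of elements of `H` are `≤ D`, then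
`p_{k+1} ≤ p_k + D` for infinitely many `k`. Proof: the two primes are `p = n + h < q = n + h'`,
`q ≤ p + D`; writing `p = p_j` (`j = #{primes ≤ p} − 1`, `Nat.nth_count`) one has `p_{j+1} ≤ q`
because `q` is a prime `> p_j` (`Nat.count_strict_mono`, `Nat.nth_le_nth`), and `j ≥ K` as soon as
`p ≥ p_K`, which holds for `n` large since `H` is bounded below.
[cite: MaynardAnnals2015, Proposition 4.2 (last sentence)] -/
theorem frequently_nth_prime_succ_le_of_frequently_two_le_card {H : Finset ℤ} {D : ℕ}
    (hD : ∀ h ∈ H, ∀ h' ∈ H, h' - h ≤ D)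
    (h2 : ∃ᶠ n : ℕ in atTop,
      2 ≤ #(H.filter fun h ↦ 0 < (n : ℤ) + h ∧ ((n : ℤ) + h).toNat.Prime)) :
    ∃ᶠ k in atTop, Nat.nth Nat.Prime (k + 1) ≤ Nat.nth Nat.Prime k + D := by
  obtain ⟨m, hm⟩ := H.bddBelow
  rw [frequently_atTop] at h2 ⊢
  intro K
  obtain ⟨n, hn, hcard⟩ := h2 ((Nat.nth Nat.Prime K : ℤ) - m).toNat
  obtain ⟨a, ha, b, hb, hab⟩ := Finset.one_lt_card.1 hcard
  simp only [Finset.mem_filter] at ha hb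
  wlog hlt : a < b generalizing a b
  · exact this b a hab.symm hb ha (lt_of_le_of_ne (not_lt.1 hlt) hab.symm)
  obtain ⟨p, hp⟩ : ∃ p : ℕ, (p : ℤ) = n + a := ⟨_, Int.toNat_of_nonneg ha.2.1.le⟩
  obtain ⟨q, hq⟩ : ∃ q : ℕ, (q : ℤ) = n + b := ⟨_, Int.toNat_of_nonneg hb.2.1.le⟩
  have hpP : p.Prime := by have := ha.2.2; rwa [← hp, Int.toNat_natCast] at this
  have hqP : q.Prime := by have := hb.2.2; rwa [← hq, Int.toNat_natCast] at this
  have hpq : p < q := by omega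
  have hqD : q ≤ p + D := by have := hD a ha.1 b hb.1; omega
  have hKp : Nat.nth Nat.Prime K ≤ p := by have := hm ha.1; omega
  refine ⟨Nat.count Nat.Prime p, ?_, ?_⟩
  · have := Nat.count_monotone Nat.Prime hKp
    rwa [Nat.count_nth_of_infinite Nat.infinite_setOf_prime] at this
  · rw [Nat.nth_count hpP]
    calc Nat.nth Nat.Prime (Nat.count Nat.Prime p + 1)
        ≤ Nat.nth Nat.Prime (Nat.count Nat.Prime q) :=
          (Nat.nth_le_nth Nat.infinite_setOf_prime).2 (Nat.count_strict_mono hpP hpq)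
      _ = q := Nat.nth_count hqP
      _ ≤ p + D := hqD

end Literature.NumberTheory.Sieve

namespace Literature.NumberTheory.Sieve

/-- **Maynard's Theorem 1.4, first clause, as a deduction** (Maynard, Ann. of Math. 181 (2015),
§4, p. 8: "we take `k = 5` and `H = {0, 2, 6, 8, 12}`, with `θ = 1 − ε` … By Proposition 4.3 we
have `M_5 > 2`, and so `θ M_5/2 > 1` for `ε` sufficiently small. Thus, by Proposition 4.2,
`liminf_n (p_{n+1} − p_n) ≤ 12` under the Elliott–Halberstam conjecture"). Formally: from the named
facts `Literature.NumberTheory.Sieve.elliottHalberstam_iff_wave0` (bridge between the two vendored forms of the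
Elliott–Halberstam conjecture), `Literature.NumberTheory.Sieve.frequently_card_primes_ge_of_maynardFunctional` (Prop. 4.2 with
Thm 3.1's conclusion) and `Literature.NumberTheory.Sieve.exists_two_lt_maynardFunctional_five` (Prop. 4.3 (1), `M_5 > 2`), the
Wave0 target `frequently_nth_prime_succ_le_add_of_elliottHalberstam` (parity.S13: EH ⇒ infinitely
often `p_{n+1} ≤ p_n + 12`) follows. The level is any `θ` with `2 / M < θ < 1`, where
`M = (∑ₘ J_5^{(m)}(F)) / I_5(F) > 2` for the admissible `F` of Prop. 4.3, so that `2 · 1 / θ < M`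
and Prop. 4.2 applies with `m = 1`, `k = 5`. [cite: MaynardAnnals2015, Theorem 1.4 and its proof in §4] -/
theorem frequently_nth_prime_succ_le_add_of_elliottHalberstam_of
    (hA : Literature.NumberTheory.Sieve.elliottHalberstam_iff_wave0)
    (hB : Literature.NumberTheory.Sieve.frequently_card_primes_ge_of_maynardFunctional)
    (hC : Literature.NumberTheory.Sieve.exists_two_lt_maynardFunctional_five) :
    frequently_nth_prime_succ_le_add_of_elliottHalberstam := by
  intro hEH
  obtain ⟨F, hF, hM⟩ := hC
  have hM0 : 0 < maynardFunctional 5 F := by linarith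
  -- a level `θ` with `2 / M < θ < 1`
  obtain ⟨θ, hθl, hθ1⟩ := exists_between ((div_lt_one hM0).2 hM)
  have hθ0 : 0 < θ := lt_trans (by positivity) hθl
  have hlevel : PrimesHaveLevel θ := hA.2 hEH θ hθ1
  have h2 : 2 * ((1 : ℕ) : ℝ) / θ < maynardFunctional 5 F := by
    rw [Nat.cast_one, mul_one]
    rwa [div_lt_comm₀ hM0 hθ0] at hθl
  have hfreq := hB θ hθ0 hlevel 1 5 F hF h2 {0, 2, 6, 8, 12} isAdmissibleTuple_maynardFive
    (by decide)
  refine frequently_nth_prime_succ_le_of_frequently_two_le_card (D := 12) ?_ hfreq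
  intro h hh h' hh'
  simp only [Finset.mem_insert, Finset.mem_singleton] at hh hh'
  omega

end Literature.NumberTheory.Sieve
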